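import Literature.Computability.Cryptography.CoinChunks
import Literature.Probability.Distributions.IndepProductLaw
import Mathlib.Probability.Distributions.Uniform
import HarnessLib

/-!
# Laws read off a uniform coin string: blocks are independent uniform words, coordinatewise maps give product laws

Topic `Computability/Cryptography`, `PMF`-level companion of `CoinChunks.lean` (the counting identity
`sum_vector_chunks`: summing a function of the chunks of a string over all strings of length `C ≥ KL`
gives `2^{C-KL}` times its sum over all families of words) and of `Probability/Distributions/IndepProductLaw.lean`
(`indepLaw K p`, the law of `K` independent coordinates, `indepLaw_apply`, `indepLaw_eq_of_apply`).
A randomised reduction of the tree reads its coins as ONE uniform string (`OracleAlg.randRun`: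
`r` uniform in `{0,1}^{coins(|x|)}`); when it cuts the string into blocks — one block per independent
repetition, and inside a block one sub-block per sampled coordinate plus the coins passed to a
subroutine (the first component of Peikert's `GapSVP → LWE` reduction, `Cryptography/PeikertReduction.lean`,
pqc.S20: `N` iterations, each sampling an `n`-dimensional perturbation and running the BDD solver with
fresh coins) — its analysis needs the joint law of what it reads as a PRODUCT law, so that the product
rule and the union bound over repetitions (`ProductLawEvents.lean`, `toOuterMeasure_indepLaw_pi`) and
per-coordinate statistical estimates (`tvDist_indepLaw_le`) apply. This file provides the three
bridges, all PROVED (theorems only):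

* `PMF.map_uniformOfFintype_apply` — `((U α).map f)(b) = #{a | f a = b}/#α`;
  `PMF.uniformOfFintype_map_equiv` — a bijection carries the uniform law to the uniform law;
* **`uniformVector_map_chunks_eq_indepLaw`** — the `L` chunks of width `K` of a uniform string of
  length `C ≥ KL` are INDEPENDENT UNIFORM words: `(U {0,1}^C).map (chunks K L) = ⨂ᴸ U {0,1}^K`;
* **`uniformPi_map_eq_indepLaw`** — applying a map `g` coordinatewise to a uniform family of words gives
  the independent product of the image laws: `(U (Fin n → W)).map (v ↦ (g (v i))ᵢ) = ⨂ⁿ ((U W).map g)`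
  (e.g. `g` = a coin-driven sampler, whose image law is its exact output law);
* `uniformVector_map_vecSplit` — a uniform string split at `K` is a pair of independent uniform strings
  (`(U {0,1}^C).map (vecSplit K C) = U ({0,1}^K × {0,1}^{C-K})`, the uniform law of the product).

## References

* S. Arora, B. Barak, *Computational Complexity: A Modern Approach*, CUP 2009, Def. 7.1 and §7.4.1
  (a probabilistic machine reads a uniform random string; independent repetitions) [AroraBarak2009].
* W. Feller, *An Introduction to Probability Theory and Its Applications I*, 3rd ed., Wiley 1968, Ch. IX §1
  (independent trials, product probabilities) [folklore].
-/

noncomputable section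

open Finset
open scoped ENNReal

/-! ### Images of the uniform law -/

namespace PMF

variable {α β : Type*} [Fintype α] [Nonempty α]

/-- **The image of the uniform law, pointwise**: `((U α).map f)(b) = #{a | f a = b}/#α`. [folklore] -/
theorem map_uniformOfFintype_apply [DecidableEq β] (f : α → β) (b : β) :
    (uniformOfFintype α).map f b = ((univ.filter fun a => f a = b).card : ℝ≥0∞) / Fintype.card α := by
  classical
  have hset : (univ.filter fun x : α => x ∈ f ⁻¹' {b}) = univ.filter fun a => f a = b := by
    ext a; simp
  rw [← toOuterMeasure_apply_singleton, toOuterMeasure_map_apply, uniformOfFintype,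
    toOuterMeasure_uniformOfFinset_apply, card_univ, hset]

omit [Nonempty α] in
/-- **A bijection carries the uniform law to the uniform law.** [folklore] -/
theorem uniformOfFintype_map_equiv [Fintype β] [Nonempty α] [Nonempty β] (e : α ≃ β) :
    (uniformOfFintype α).map e = uniformOfFintype β := by
  classical
  ext b
  rw [map_uniformOfFintype_apply, uniformOfFintype_apply, Fintype.card_congr e]
  have hone : (univ.filter fun a => e a = b).card = 1 := by
    rw [card_eq_one]
    refine ⟨e.symm b, ?_⟩
    ext a
    simp [Equiv.apply_eq_iff_eq_symm_apply]
  rw [hone, Nat.cast_one, one_div]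

end PMF

namespace Literature.Computability.Cryptography

open PMF Literature.Probability.Distributions

/-! ### The chunks of a uniform string are independent uniform words -/

/-- **The `L` chunks of width `K` of a uniform string of length `C ≥ KL` are independent uniform words**:
`(U {0,1}^C).map (chunks K L) = ⨂_{j<L} U {0,1}^K` (each family of words has exactly `2^{C-KL}`
preimages, `sum_vector_chunks`). [cite: AroraBarak2009, Def. 7.1] -/
theorem uniformVector_map_chunks_eq_indepLaw (K L : ℕ) {C : ℕ} (hC : K * L ≤ C) :
    (uniformOfFintype (List.Vector Bool C)).map (chunks K L hC) =
      indepLaw L fun _ => uniformOfFintype (List.Vector Bool K) := by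
  classical
  refine indepLaw_eq_of_apply _ _ fun y => ?_
  rw [map_uniformOfFintype_apply]
  -- the number of preimages of `y`
  have hcount : ((univ.filter fun r : List.Vector Bool C => chunks K L hC r = y).card : ℝ≥0∞) =
      (2 : ℝ≥0∞) ^ (C - K * L) := by
    have h := sum_vector_chunks K L hC (M := ℕ) fun y' => if y' = y then 1 else 0
    rw [Finset.sum_boole, Finset.sum_boole] at h
    have h1 : (univ.filter fun y' : Fin L → List.Vector Bool K => y' = y).card = 1 := by
      rw [card_eq_one]; exact ⟨y, by ext; simp⟩
    rw [h1] at h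
    have h' : (univ.filter fun r : List.Vector Bool C => chunks K L hC r = y).card = 2 ^ (C - K * L) := by
      simpa using h
    rw [h']
    push_cast
    rfl
  rw [hcount, card_vector, Fintype.card_bool]
  simp only [uniformOfFintype_apply, card_vector, Fintype.card_bool, Finset.prod_const, card_univ,
    Fintype.card_fin]
  push_cast
  -- `2^{C-KL}/2^C = (2^K)⁻¹^L`
  have h2 : (2 : ℝ≥0∞) ≠ 0 := two_ne_zero
  have h2t : (2 : ℝ≥0∞) ≠ ∞ := ENNReal.ofNat_ne_top
  obtain ⟨D, rfl⟩ := Nat.exists_eq_add_of_le hC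
  rw [Nat.add_sub_cancel_left, pow_add, ENNReal.inv_pow, ← pow_mul, ENNReal.div_eq_inv_mul,
    ENNReal.mul_inv (Or.inl (pow_ne_zero _ h2)) (Or.inl (ENNReal.pow_ne_top h2t)), mul_assoc,
    ENNReal.inv_mul_cancel (pow_ne_zero _ h2) (ENNReal.pow_ne_top h2t), mul_one, ENNReal.inv_pow]

/-! ### Coordinatewise maps of a uniform family give product laws -/

/-- **Applying a map coordinatewise to a uniform family of words gives the independent product of the
image laws**: `(U (Fin n → W)).map (v ↦ (g (v i))ᵢ) = ⨂ᵢ ((U W).map g)` — the preimages of a tuple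
form a box (`Fintype.card_piFinset`). [cite: AroraBarak2009, Def. 7.1] -/
theorem uniformPi_map_eq_indepLaw {W α : Type*} [Fintype W] [Nonempty W] [DecidableEq α] (n : ℕ)
    (g : W → α) :
    (uniformOfFintype (Fin n → W)).map (fun v i => g (v i)) = indepLaw n fun _ => (uniformOfFintype W).map g := by
  classical
  refine indepLaw_eq_of_apply _ _ fun y => ?_
  rw [map_uniformOfFintype_apply]
  have hbox : (univ.filter fun v : Fin n → W => (fun i => g (v i)) = y) =
      Fintype.piFinset fun i => univ.filter fun w : W => g w = y i := by
    ext v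
    simp only [mem_filter, mem_univ, true_and, Fintype.mem_piFinset, funext_iff]
  rw [hbox, Fintype.card_piFinset, Fintype.card_pi]
  simp_rw [map_uniformOfFintype_apply]
  push_cast
  simp_rw [ENNReal.div_eq_inv_mul]
  rw [Finset.prod_mul_distrib, Finset.prod_const, Finset.prod_const, card_univ, Fintype.card_fin,
    ENNReal.inv_pow]

/-! ### Splitting a uniform string; the uniform law of a product -/

/-- **A uniform string split at `K` is a uniform pair of strings** (prefix of length `K`, suffix of
length `C - K`). [cite: AroraBarak2009, Def. 7.1] -/
theorem uniformVector_map_vecSplit (K C : ℕ) (h : K ≤ C) :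
    (uniformOfFintype (List.Vector Bool C)).map (vecSplit K C h) =
      uniformOfFintype (List.Vector Bool K × List.Vector Bool (C - K)) :=
  uniformOfFintype_map_equiv (vecSplit K C h)

/-- **The uniform law of a product is the independent pair of uniform laws**, in the `bind`/`map` form
`U(α × β) = do a ← U α; b ← U β; return (a, b)` (the shape in which "coins independent of the
perturbation" enters `Peikert2009.prob_names_perturbation_le`). [folklore] -/
theorem uniformOfFintype_prod_eq_bind {α β : Type*} [Fintype α] [Nonempty α] [Fintype β] [Nonempty β] :
    uniformOfFintype (α × β) = (uniformOfFintype α).bind fun a => (uniformOfFintype β).map (Prod.mk a) := by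
  classical
  ext p
  rw [uniformOfFintype_apply, PMF.bind_apply, tsum_eq_single p.1]
  · rw [PMF.map_apply, tsum_eq_single p.2]
    · rw [if_pos (by simp), uniformOfFintype_apply, uniformOfFintype_apply, Fintype.card_prod, Nat.cast_mul,
        ENNReal.mul_inv (Or.inl (by exact_mod_cast Fintype.card_ne_zero)) (Or.inl (ENNReal.natCast_ne_top _))]
    · intro b hb
      rw [if_neg]
      intro h
      exact hb (by rw [h])
  · intro a ha
    rw [PMF.map_apply, ENNReal.tsum_eq_zero.2, mul_zero]
    intro b
    rw [if_neg]
    intro h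
    exact ha (by rw [h])

end Literature.Computability.Cryptography

end
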